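import Mathlib
import HarnessLib
import Summits.ValiantsHypothesis.ValiantsHypothesis.Theorems.LacunarySymmetroidMatrixDescartesOsculationLawCuspCubic

/-!
# ValiantsHypothesis / LacunarySymmetroid — crux `MatrixDescartes` (stmt-ValiantsHypothesis-18050, V1),
# line «osculation-law»: the MONIC QUARTIC cusp curve `b⁴ + σ₁b³ + σ₂b² + σ₃b + σ₄ = 0` — θ-calculus and the
# Euclid cascade identities

Towards the splitting `(r, s) = (4, 0)` of the `m = 4` rung of the line's law (desk RULING #260 (b)): the insertion
polynomial of a symmetric `4 × 4` pencil with the full-rank letter is the MONIC QUARTIC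
`Φ = det(G(t) + b·I₄) = b⁴ + σ₁b³ + σ₂b² + σ₃b + σ₄`.  This file (1/· of the `(4,0)` piece; no definitions, no named
facts; light — the heavy reduction `H = Q·Φ + R₃b³ + R₂b² + R₁b + R₀` is the sibling `…CuspQuarticReduction`) supplies:

* `eval_Phi4`, `eval_logHessian_Phi4` — θ-calculus for `Φ = X₁⁴ + X₁³·ι σ₁ + X₁²·ι σ₂ + X₁·ι σ₃ + ι σ₄`;
* the TWO-LEVEL Euclid cascade as generic ring identities (any scalars): `euclid4_step1`
  (`r₃²·Φ = (r₃ b + (s₁r₃ − r₂))·R + (ℓ₂b² + ℓ₁b + ℓ₀)` for the cubic remainder `R = r₃b³ + r₂b² + r₁b + r₀`, with the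
  quadratic `ℓ` written out), `euclid4_step2` (`ℓ₂²·R = (ℓ₂ r₃ b + (r₂ℓ₂ − r₃ℓ₁))·L + (m₁ b + m₀)`, with the linear `m`
  written out), and the resultant steps `resultant4_lin` (`m₁b + m₀ = 0 ⇒ ℓ₂m₀² − ℓ₁m₀m₁ + ℓ₀m₁² = m₁²·L(b)`),
  `resultant4_quad` (quadratic-remainder regime: `r₂b² + r₁b + r₀ = 0`, … ) — the skeleton of the count's strata.

Honest framing: helper algebra for a located rung piece of an UNREGISTERED V1 law line (ideator val-idea-2);
`OsculationLaw` (all `m`), `PeelInequality`, `MatrixDescartes`, Conjecture B and `VP ≠ VNP` are OPEN / NOT proved.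
-/

-- `Summit.ValiantsHypothesis.ValiantsHypothesis.…` is the tree's mandated single-conjunct layout (Sub = Summit).
set_option linter.dupNamespace false

noncomputable section

namespace Summit.ValiantsHypothesis.ValiantsHypothesis.Theorems.LacunarySymmetroidMatrixDescartes

open Polynomial Set
open scoped BigOperators

namespace OsculationCuspQuartic

/-! ### θ-calculus for `Φ = X₁⁴ + X₁³·ι σ₁ + X₁²·ι σ₂ + X₁·ι σ₃ + ι σ₄` -/

/-- `Φ(t,b) = b⁴ + σ₁(t)b³ + σ₂(t)b² + σ₃(t)b + σ₄(t)`. [folklore] -/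
theorem eval_Phi4 (σ₁ σ₂ σ₃ σ₄ : ℝ[X]) (p : Fin 2 → ℝ) :
    MvPolynomial.eval p (MvPolynomial.X 1 * MvPolynomial.X 1 * MvPolynomial.X 1 * MvPolynomial.X 1 + MvPolynomial.X 1 * MvPolynomial.X 1 * MvPolynomial.X 1 * Polynomial.aeval (MvPolynomial.X 0 : MvPolynomial (Fin 2) ℝ) σ₁ + MvPolynomial.X 1 * MvPolynomial.X 1 * Polynomial.aeval (MvPolynomial.X 0 : MvPolynomial (Fin 2) ℝ) σ₂ + MvPolynomial.X 1 * Polynomial.aeval (MvPolynomial.X 0 : MvPolynomial (Fin 2) ℝ) σ₃ + Polynomial.aeval (MvPolynomial.X 0 : MvPolynomial (Fin 2) ℝ) σ₄) =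
      p 1 ^ 4 + p 1 ^ 3 * σ₁.eval (p 0) + p 1 ^ 2 * σ₂.eval (p 0) + p 1 * σ₃.eval (p 0) + σ₄.eval (p 0) := by
  simp only [map_add, map_mul, MvPolynomial.eval_X, OsculationRankOne.eval_aevalX0]
  ring

set_option maxRecDepth 100000 in
/-- The bordered log-Hessian of the monic quartic at `p = (t,b)` in the scalars `σᵢ(t)`, `θσᵢ(t)`, `θ²σᵢ(t)`. [folklore] -/
theorem eval_logHessian_Phi4 (σ₁ σ₂ σ₃ σ₄ : ℝ[X]) (Φ : MvPolynomial (Fin 2) ℝ) (hΦ : Φ = (MvPolynomial.X 1 * MvPolynomial.X 1 * MvPolynomial.X 1 * MvPolynomial.X 1 + MvPolynomial.X 1 * MvPolynomial.X 1 * MvPolynomial.X 1 * Polynomial.aeval (MvPolynomial.X 0 : MvPolynomial (Fin 2) ℝ) σ₁ + MvPolynomial.X 1 * MvPolynomial.X 1 * Polynomial.aeval (MvPolynomial.X 0 : MvPolynomial (Fin 2) ℝ) σ₂ + MvPolynomial.X 1 * Polynomial.aeval (MvPolynomial.X 0 : MvPolynomial (Fin 2) ℝ) σ₃ + Polynomial.aeval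 (MvPolynomial.X 0 : MvPolynomial (Fin 2) ℝ) σ₄))
    (p : Fin 2 → ℝ) :
    MvPolynomial.eval p
        (MvPolynomial.X 0 * MvPolynomial.pderiv 0 (MvPolynomial.X 0 * MvPolynomial.pderiv 0 Φ)
            * (MvPolynomial.X 1 * MvPolynomial.pderiv 1 Φ) ^ 2
          - 2 * (MvPolynomial.X 0 * MvPolynomial.pderiv 0 (MvPolynomial.X 1 * MvPolynomial.pderiv 1 Φ))
            * (MvPolynomial.X 0 * MvPolynomial.pderiv 0 Φ) * (MvPolynomial.X 1 * MvPolynomial.pderiv 1 Φ)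
          + MvPolynomial.X 1 * MvPolynomial.pderiv 1 (MvPolynomial.X 1 * MvPolynomial.pderiv 1 Φ)
            * (MvPolynomial.X 0 * MvPolynomial.pderiv 0 Φ) ^ 2) =
      (((p 0) * (derivative σ₁).eval (p 0) + (p 0) ^ 2 * (derivative (derivative σ₁)).eval (p 0)) * (p 1) ^ 3 + ((p 0) * (derivative σ₂).eval (p 0) + (p 0) ^ 2 * (derivative (derivative σ₂)).eval (p 0)) * (p 1) ^ 2
          + ((p 0) * (derivative σ₃).eval (p 0) + (p 0) ^ 2 * (derivative (derivative σ₃)).eval (p 0)) * (p 1) + ((p 0) * (derivative σ₄).eval (p 0)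
          + (p 0) ^ 2 * (derivative (derivative σ₄)).eval (p 0))) * (4 * (p 1) ^ 4 + 3 * σ₁.eval (p 0) * (p 1) ^ 3 + 2 * σ₂.eval (p 0) * (p 1) ^ 2 + σ₃.eval (p 0) * (p 1)) ^ 2
          - 2 * (3 * ((p 0) * (derivative σ₁).eval (p 0)) * (p 1) ^ 3 + 2 * ((p 0) * (derivative σ₂).eval (p 0)) * (p 1) ^ 2 + ((p 0) * (derivative σ₃).eval (p 0)) * (p 1)) * (((p 0) * (derivative σ₁).eval (p 0)) * (p 1) ^ 3
          + ((p 0) * (derivative σ₂).eval (p 0)) * (p 1) ^ 2 + ((p 0) * (derivative σ₃).eval (p 0)) * (p 1) + ((p 0) * (derivative σ₄).eval (p 0))) * (4 * (p 1) ^ 4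
          + 3 * σ₁.eval (p 0) * (p 1) ^ 3 + 2 * σ₂.eval (p 0) * (p 1) ^ 2 + σ₃.eval (p 0) * (p 1)) + (16 * (p 1) ^ 4 + 9 * σ₁.eval (p 0) * (p 1) ^ 3
          + 4 * σ₂.eval (p 0) * (p 1) ^ 2 + σ₃.eval (p 0) * (p 1)) * (((p 0) * (derivative σ₁).eval (p 0)) * (p 1) ^ 3 + ((p 0) * (derivative σ₂).eval (p 0)) * (p 1) ^ 2
          + ((p 0) * (derivative σ₃).eval (p 0)) * (p 1) + ((p 0) * (derivative σ₄).eval (p 0))) ^ 2 := by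
  subst hΦ
  simp only [map_add, map_sub, map_mul, map_pow, MvPolynomial.pderiv_mul,
    MvPolynomial.pderiv_X_self, MvPolynomial.pderiv_X_of_ne (show (1 : Fin 2) ≠ 0 by decide),
    OsculationRankOne.pderiv_zero_aevalX0, OsculationRankOne.pderiv_one_aevalX0,
    MvPolynomial.eval_X, OsculationRankOne.eval_aevalX0, map_ofNat, map_one, mul_zero, zero_mul, add_zero,
    zero_add, one_mul, mul_one]
  ring

/-! ### The Euclid cascade between the quartic and a cubic (generic identities) -/

/-- **Step 1**: `r₃²·Φ = (r₃ b + (s₁r₃ − r₂))·R + (ℓ₂b² + ℓ₁b + ℓ₀)` for `R = r₃b³ + r₂b² + r₁b + r₀`, with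
`ℓ₂ = s₂r₃² − r₁r₃ − s₁r₂r₃ + r₂²`, `ℓ₁ = s₃r₃² − r₀r₃ − s₁r₁r₃ + r₁r₂`, `ℓ₀ = s₄r₃² − s₁r₀r₃ + r₀r₂`. [folklore] -/
theorem euclid4_step1 (b s₁ s₂ s₃ s₄ r₃ r₂ r₁ r₀ : ℝ) :
    r₃ ^ 2 * (b ^ 4 + b ^ 3 * s₁ + b ^ 2 * s₂ + b * s₃ + s₄) =
      (r₃ * b + (s₁ * r₃ - r₂)) * (r₃ * b ^ 3 + r₂ * b ^ 2 + r₁ * b + r₀)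
        + ((s₂ * r₃ ^ 2 - r₁ * r₃ - s₁ * r₂ * r₃ + r₂ ^ 2) * b ^ 2
          + (s₃ * r₃ ^ 2 - r₀ * r₃ - s₁ * r₁ * r₃ + r₁ * r₂) * b
          + (s₄ * r₃ ^ 2 - s₁ * r₀ * r₃ + r₀ * r₂)) := by
  ring

/-- **Step 2**: `ℓ₂²·R = (r₃ℓ₂ b + (r₂ℓ₂ − r₃ℓ₁))·L + (m₁ b + m₀)` for `L = ℓ₂b² + ℓ₁b + ℓ₀`, with
`m₁ = r₁ℓ₂² − r₃ℓ₀ℓ₂ − r₂ℓ₁ℓ₂ + r₃ℓ₁²`, `m₀ = r₀ℓ₂² − r₂ℓ₀ℓ₂ + r₃ℓ₀ℓ₁`. [folklore] -/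
theorem euclid4_step2 (b r₃ r₂ r₁ r₀ l₂ l₁ l₀ : ℝ) :
    l₂ ^ 2 * (r₃ * b ^ 3 + r₂ * b ^ 2 + r₁ * b + r₀) =
      (r₃ * l₂ * b + (r₂ * l₂ - r₃ * l₁)) * (l₂ * b ^ 2 + l₁ * b + l₀)
        + ((r₁ * l₂ ^ 2 - r₃ * l₀ * l₂ - r₂ * l₁ * l₂ + r₃ * l₁ ^ 2) * b
          + (r₀ * l₂ ^ 2 - r₂ * l₀ * l₂ + r₃ * l₀ * l₁)) := by
  ring

/-- **Step 1, quadratic-remainder regime** (`r₃ = 0`): `r₂²·Φ = (r₂b² + (s₁r₂ − r₁)b + (s₂r₂ − r₀ − s₁r₁ + r₁²/…))·R + …`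
written without division: `r₂³·Φ = (r₂²b² + r₂(s₁r₂ − r₁)b + (s₂r₂² − r₀r₂ − s₁r₁r₂ + r₁²))·(r₂b² + r₁b + r₀) + (n₁ b + n₀)`,
`n₁ = s₃r₂³ − s₁r₀r₂² − s₂r₁r₂² + 2r₀r₁r₂ + s₁r₁²r₂ − r₁³`, `n₀ = s₄r₂³ − s₂r₀r₂² + r₀²r₂ + s₁r₀r₁r₂ − r₀r₁²`. [folklore] -/
theorem euclid4_quad (b s₁ s₂ s₃ s₄ r₂ r₁ r₀ : ℝ) :
    r₂ ^ 3 * (b ^ 4 + b ^ 3 * s₁ + b ^ 2 * s₂ + b * s₃ + s₄) =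
      (r₂ ^ 2 * b ^ 2 + r₂ * (s₁ * r₂ - r₁) * b + (s₂ * r₂ ^ 2 - r₀ * r₂ - s₁ * r₁ * r₂ + r₁ ^ 2))
          * (r₂ * b ^ 2 + r₁ * b + r₀)
        + ((s₃ * r₂ ^ 3 - s₁ * r₀ * r₂ ^ 2 - s₂ * r₁ * r₂ ^ 2 + 2 * r₀ * r₁ * r₂ + s₁ * r₁ ^ 2 * r₂ - r₁ ^ 3) * b
          + (s₄ * r₂ ^ 3 - s₂ * r₀ * r₂ ^ 2 + r₀ ^ 2 * r₂ + s₁ * r₀ * r₁ * r₂ - r₀ * r₁ ^ 2)) := by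
  ring

/-- **Linear resultant**: with `m₁ b + m₀ = 0`, `ℓ₂m₀² − ℓ₁m₀m₁ + ℓ₀m₁² = m₁²·(ℓ₂b² + ℓ₁b + ℓ₀)`. [folklore] -/
theorem resultant4_lin {b l₂ l₁ l₀ m₁ m₀ : ℝ} (hm : m₁ * b + m₀ = 0) :
    l₂ * m₀ ^ 2 - l₁ * m₀ * m₁ + l₀ * m₁ ^ 2 = m₁ ^ 2 * (l₂ * b ^ 2 + l₁ * b + l₀) := by
  have h0 : m₀ = -(m₁ * b) := by linarith
  rw [h0]; ring

/-- **Linear resultant against the quartic** (linear-remainder regime `R = r₁b + r₀`): with `r₁ b + r₀ = 0`,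
`s₄r₁⁴ − s₃r₀r₁³ + s₂r₀²r₁² − s₁r₀³r₁ + r₀⁴ = r₁⁴·Φ(b)`. [folklore] -/
theorem resultant4_quartic_lin {b s₁ s₂ s₃ s₄ r₁ r₀ : ℝ} (hr : r₁ * b + r₀ = 0) :
    s₄ * r₁ ^ 4 - s₃ * r₀ * r₁ ^ 3 + s₂ * r₀ ^ 2 * r₁ ^ 2 - s₁ * r₀ ^ 3 * r₁ + r₀ ^ 4 =
      r₁ ^ 4 * (b ^ 4 + b ^ 3 * s₁ + b ^ 2 * s₂ + b * s₃ + s₄) := by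
  have h0 : r₀ = -(r₁ * b) := by linarith
  rw [h0]; ring

end OsculationCuspQuartic

end Summit.ValiantsHypothesis.ValiantsHypothesis.Theorems.LacunarySymmetroidMatrixDescartes
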